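import Mathlib
import Summits.Ventures.PercRepro2.Defs
import Summits.Ventures.PercRepro2.Independence
import Summits.Ventures.PercRepro2.Harris
import Summits.Ventures.PercRepro2.Graph
import Summits.Ventures.PercRepro2.Exploration
import Summits.Ventures.PercRepro2.Events
import Summits.Ventures.PercRepro2.FourFunctions
import Summits.Ventures.PercRepro2.Induced
import Summits.Ventures.PercRepro2.Frontier
import Summits.Ventures.PercRepro2.ObsIndependence
import Summits.Ventures.PercRepro2.BHK
import Summits.Ventures.PercRepro2.BHKEvents
import Summits.Ventures.PercRepro2.SideAgreement
import Summits.Ventures.PercRepro2.VdBKahn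
import Summits.Ventures.PercRepro2.BHKAvoid
import Summits.Ventures.PercRepro2.R2PrimeThreeReduction
import Summits.Ventures.PercRepro2.YBridge
import Summits.Ventures.PercRepro2.Yu1Functionals
import Summits.Ventures.PercRepro2.Yu1Events
import Summits.Ventures.PercRepro2.Yu1
import Summits.Ventures.PercRepro2.LBSplit
import Summits.Ventures.PercRepro2.YDelta
import Summits.Ventures.PercRepro2.SD
import Summits.Ventures.PercRepro2.Threshold
import Summits.Ventures.PercRepro2.Lambda
import Summits.Ventures.PercRepro2.LambdaTau
import Summits.Ventures.PercRepro2.LambdaSlack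
import Summits.Ventures.PercRepro2.HF2
import Summits.Ventures.PercRepro2.Yu2
import Summits.Ventures.PercRepro2.N0
import Summits.Ventures.PercRepro2.Y
import Summits.Ventures.PercRepro2.YDeltaTools
import Summits.Ventures.PercRepro2.ZDelta
import Summits.Ventures.PercRepro2.ZExpand
import Summits.Ventures.PercRepro2.ISplit
import Summits.Ventures.PercRepro2.MRl
import Summits.Ventures.PercRepro2.ZOloc
import Summits.Ventures.PercRepro2.SideBridge
import Summits.Ventures.PercRepro2.HCov
import Summits.Ventures.PercRepro2.HCovFns
import Summits.Ventures.PercRepro2.HCovSwap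
import Summits.Ventures.PercRepro2.BasePrime
import Summits.Ventures.PercRepro2.PendantRoot
import Summits.Ventures.PercRepro2.PendantO
import Summits.Ventures.PercRepro2.PendantB
import Summits.Ventures.PercRepro2.PendantBRow
import Summits.Ventures.PercRepro2.LeafStep

/-!
# `T₀ ≥ 0` and the leaf step without side conditions (blind cell PercRepro2, p1 g7; follow-up of
`LeafStep.lean`)

`T₀ = 2P(Q)·(Z_L + Z_H)` with the two BHK 1.4 slacks `Z_L = oL·bH − P·Dd`, `Z_H = oH·bL − P·C`
(`T0_eq`), hence `0 ≤ T₀` (`T0_nonneg`, from `PendantB.ZL_nonneg` / `ZH_nonneg`), and the leaf step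
reads **`HCov_leaf : HCov p o a₁ a₂ v b → LeafRow p o a₁ a₂ v b → HCov p o a₁ a₂ a₃ b`**.
-/

namespace Summit.Ventures.PercRepro2

open UnionCluster CovForm PendantRoot PendantO

namespace LeafStep

variable {V : Type*} {E : Type*} [Fintype E] [DecidableEq E] [Fintype V] [DecidableEq V]
  {R : Type*} [Field R] [LinearOrder R] [IsStrictOrderedRing R]

variable (p : E → R) (ends : E → Sym2 V)

omit [Fintype V] [DecidableEq V] in
/-- `T₀ = 2P(Q)·[(oL·bH − P·Dd) + (oH·bL − P·C)]`. -/
lemma T0_eq (o a₁ a₂ b : V) :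
    T0 p ends o a₁ a₂ b =
      2 * prob p (avoidAll ends a₂ {a₁}) *
        ((prob p (avoidAll ends a₂ {a₁} ∩ connEvent ends a₁ o) *
            prob p (avoidAll ends a₂ {a₁} ∩ connEvent ends a₂ b) -
          prob p (avoidAll ends a₂ {a₁}) *
            prob p (avoidAll ends a₂ {a₁} ∩ (connEvent ends a₁ o ∩ connEvent ends a₂ b))) +
         (prob p (avoidAll ends a₂ {a₁} ∩ connEvent ends a₂ o) *
            prob p (avoidAll ends a₂ {a₁} ∩ connEvent ends a₁ b) -
          prob p (avoidAll ends a₂ {a₁}) *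
            prob p (avoidAll ends a₂ {a₁} ∩ (connEvent ends a₂ o ∩ connEvent ends a₁ b)))) := by
  unfold T0 mU mUU EQbo EQo
  rw [gap_eq_Q]
  ring

/-- **`0 ≤ T₀`** (two BHK 1.4 instances). -/
theorem T0_nonneg (hp : IsProbVec p) (o a₁ a₂ b : V) : 0 ≤ T0 p ends o a₁ a₂ b := by
  rw [T0_eq]
  have hZL := PendantB.ZL_nonneg p ends hp o a₁ a₂ b
  have hZH := PendantB.ZH_nonneg p ends hp o a₁ a₂ b
  have hP := prob_nonneg hp (avoidAll ends a₂ {a₁})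
  have h2 : (0 : R) ≤ 2 := by norm_num
  exact mul_nonneg (mul_nonneg h2 hP) (add_nonneg (sub_nonneg.2 hZL) (sub_nonneg.2 hZH))

/-- **THE LEAF STEP**: (HCOV) at the marker `v` and the row `0 ≤ R½` give (HCOV) at a leaf `a₃`
attached to `v` (no further hypothesis). -/
theorem HCov_leaf (hp : IsProbVec p) {f : E} {a₃ v : V} (hf : ends f = s(a₃, v))
    (hleaf : ∀ e, a₃ ∈ ends e → e = f) (h3v : a₃ ≠ v) {o a₁ a₂ b : V} (h31 : a₃ ≠ a₁)
    (h32 : a₃ ≠ a₂) (ho : o ≠ a₃) (hb : b ≠ a₃) (hv : HCov p ends o a₁ a₂ v b)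
    (hrow : LeafRow p ends o a₁ a₂ v b) : HCov p ends o a₁ a₂ a₃ b :=
  HCov_leaf_of p ends hp hf hleaf h3v h31 h32 ho hb hv hrow (T0_nonneg p ends hp o a₁ a₂ b)

end LeafStep

end Summit.Ventures.PercRepro2
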